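/-
Copyright (c) 2026. All rights reserved.
Released under Apache 2.0 license as described in the file LICENSE.
-/
import Literature.NumberTheory.PAdicHodge.FontainePstLabelledWeightsDetSchema
import Literature.NumberTheory.PAdicHodge.DeRhamFilteredComparison
import Literature.NumberTheory.GaloisRepresentations.LabelledWeightsDet
import Literature.NumberTheory.GaloisRepresentations.LabelledWeightsCoeffBaseChange
import Literature.NumberTheory.GaloisRepresentations.LabelledWeightsDeRhamRank
import Literature.NumberTheory.GaloisRepresentations.PstWeilDeligneTwistDeRham
import HarnessLib

/-!
# `LabelledWeightsDetSchema` holds: `HT_τ(det ρ) = {Σ HT_τ(ρ)}` for THE pinned Fontaine datum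

We discharge the named fact `Literature.NumberTheory.PAdicHodge.LabelledWeightsDetSchema`
(`FontainePstLabelledWeightsDetSchema`): for an `ℓ`-adic local field `K`, a framed
`ρ : Γ_K → GL_n(ℚ̄_ℓ)` de Rham for `fontainePst K ℓ hK` and a `ℚ_ℓ`-label `τ : K → ℚ̄_ℓ`, the
character `det ρ` (as the framed representation `scalar ∘ det ρ`) has
`HT_τ(det ρ) = {Σ HT_τ(ρ)}` (`LabelledWeightsDetSchema_holds`).

## Proof

* `HasQlModel.scalar_comp_det`: a model `rE'` of `ρ` over a finite `E' ⊆ ℚ̄_ℓ` gives the model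
  `scalar ∘ det rE'` of `scalar ∘ det ρ`.
* `labelledHodgeTateWeights_scalar_comp_det_of_eq_bdR`: for the period-ring datum `B_dR(K)`
  (`bdRPeriodRingData`) and `ρ` de Rham, choose a finite admissible model `rE'` over `E'` containing
  all `τ(K)` (accepted `IsDeRhamWith.exists_hasQlModel_labelledHodgeTateWeights_eq`), read both sides
  on the model (accepted `labelledHodgeTateWeights_eq_of_hasQlModel`), feed Wach's filtered comparison
  for `rE'` (accepted `exists_basis_mem_filTensor_iff_of_isDeRham`) into the abstract theorem
  `PeriodRingData.labelledHodgeTateWeights_scalar_comp_det` (`LabelledWeightsDet`).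
* THE pinned datum has period ring `B_dR(K)` (accepted `fontainePst_𝔅_eq_bdRPeriodRingData`) and
  `K/ℚ_ℓ` finite for its `ℚ_ℓ`-structure (accepted `fontainePst_finiteDimensional`).

## References
* [Patrikis2019] S. Patrikis, *Variations on a theorem of Tate*, Mem. AMS 258 (2019), §2.3.1, §2.7.1.
* [FontaineAsterisque223III] J.-M. Fontaine, Astérisque 223 (1994), Exp. III §1.5, Prop. 1.5.2,
  Thm. 1.5.2.
* [BrinonConrad2009] O. Brinon, B. Conrad, *CMI Summer School notes on p-adic Hodge theory* (2009),
  §6.3.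
* [Wach1996] N. Wach, Bull. SMF 124 (1996), §B.2.3, proof of Prop. 2 (p. 394).
-/

noncomputable section

open scoped TensorProduct
open Field ValuativeRel
open Literature.NumberTheory.GaloisRepresentations
open Literature.NumberTheory.Automorphic

/-! ### The determinant of a model is a model of the determinant (as framed representations) -/

namespace Literature.NumberTheory.GaloisRepresentations

/-- **`scalar ∘ det rE` is a model of `scalar ∘ det ρ`** whenever `rE` is a model of `ρ` over
`E ⊆ ℚ̄_ℓ`: `det ρ(g) = det rE(g)` in `ℚ̄_ℓ` (accepted `HasQlModel.coe_det_apply`), and a `1 × 1`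
framed representation is conjugation-invariant.  Deliberate dot-notation extension of the accepted
`Literature.NumberTheory.Automorphic.HasQlModel`. [cite: BuzzardGeeLMS2014, §2.2] -/
theorem _root_.Literature.NumberTheory.Automorphic.HasQlModel.scalar_comp_det
    {K : Type} [Field K] {ℓ : ℕ} [Fact ℓ.Prime] {n : ℕ}
    {r : FramedRep (absoluteGaloisGroup K) (PadicAlgCl ℓ) n} {E : IntermediateField ℚ_[ℓ] (PadicAlgCl ℓ)}
    {rE : FramedRep (absoluteGaloisGroup K) E n} (h : HasQlModel r E rE) :
    HasQlModel ((FramedRep.scalar (PadicAlgCl ℓ) 1).comp (FramedRep.det r)) E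
      ((FramedRep.scalar E 1).comp (FramedRep.det rE)) := by
  refine ⟨1, ContinuousMonoidHom.ext fun g => Units.ext (Matrix.ext fun i j => ?_)⟩
  obtain rfl : i = j := Subsingleton.elim i j
  rw [FramedRep.conj_apply, one_mul, inv_one, mul_one, FramedRep.coe_baseChange_apply,
    Matrix.map_apply]
  show algebraMap E (PadicAlgCl ℓ)
      (((FramedRep.scalar E 1 (FramedRep.det rE g) : GL (Fin 1) E) : Matrix (Fin 1) (Fin 1) E) i i) =
    ((FramedRep.scalar (PadicAlgCl ℓ) 1 (FramedRep.det r g) : GL (Fin 1) (PadicAlgCl ℓ)) :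
      Matrix (Fin 1) (Fin 1) (PadicAlgCl ℓ)) i i
  rw [FramedRep.coe_scalar_apply, FramedRep.coe_scalar_apply, Matrix.algebraMap_matrix_apply,
    Matrix.algebraMap_matrix_apply, if_pos rfl, if_pos rfl, Algebra.algebraMap_self_apply,
    Algebra.algebraMap_self_apply, h.coe_det_apply g]

end Literature.NumberTheory.GaloisRepresentations

namespace Literature.NumberTheory.PAdicHodge

-- Mathlib's own global value of `maxSynthPendingDepth` (see `LabelledWeightsTwist`); the tensor
-- types need a higher instance-synthesis budget.
set_option maxSynthPendingDepth 3
set_option synthInstance.maxHeartbeats 200000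

variable {K : Type} [Field K] [ValuativeRel K] [TopologicalSpace K] [IsNonarchimedeanLocalField K]
  [CharZero K] {ℓ : ℕ} [Fact ℓ.Prime]

/-- **`HT_τ(det ρ) = {Σ HT_τ(ρ)}` for Fontaine's `B_dR(K)`** (any `ℚ_ℓ`-structure on `K` with `K/ℚ_ℓ`
finite; `𝔅 = bdRPeriodRingData hK`, stated through an equation so as to apply to THE pinned datum) and
a de Rham framed `ρ : Γ_K → GL_n(ℚ̄_ℓ)`: read on a finite admissible model over `E' ⊇ τ(K)`, where
it is the abstract `PeriodRingData.labelledHodgeTateWeights_scalar_comp_det` fed with Wach's filtered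
comparison for `B_dR`. [cite: Patrikis2019, §2.3.1 and §2.7.1] [cite: FontaineAsterisque223III, Exp. III Prop. 1.5.2 and Thm. 1.5.2] [cite: Wach1996, §B.2.3, proof of Prop. 2 (p. 394)] -/
theorem labelledHodgeTateWeights_scalar_comp_det_of_eq_bdR (hK : valuation K ℓ < 1) [Algebra ℚ_[ℓ] K]
    [FiniteDimensional ℚ_[ℓ] K] [Fact (¬ IsUnit ((ℓ : ℕ) : integerC K))]
    [IsAdicComplete (Ideal.span {((ℓ : ℕ) : integerC K)}) (integerC K)]
    (𝔅 : PeriodRingData.{0, 0, 0, 0} (absoluteGaloisGroup K) ℚ_[ℓ] K)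
    (h𝔅 : 𝔅 = bdRPeriodRingData (F := K) (p := ℓ) hK) {n : ℕ}
    {ρ : FramedRep (absoluteGaloisGroup K) (PadicAlgCl ℓ) n}
    (hρ : ρ.IsDeRhamWith ‹Algebra ℚ_[ℓ] K› 𝔅) (τ : K →ₐ[ℚ_[ℓ]] PadicAlgCl ℓ) :
    𝔅.labelledHodgeTateWeights
        (FramedRep.toContinuousRep ((FramedRep.scalar (PadicAlgCl ℓ) 1).comp (FramedRep.det ρ)))
        τ.toRingHom =
      {(𝔅.labelledHodgeTateWeights (FramedRep.toContinuousRep ρ) τ.toRingHom).sum} := by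
  classical
  have hB : IsField 𝔅.B := by
    haveI := isDomain_bDeRhamPlus (F := K) (p := ℓ) (surjective_fontaineTheta_integerC hK)
    rw [h𝔅]
    exact Field.toIsField (FracBdR K ℓ)
  -- a finite admissible model computing the weights
  obtain ⟨E', hfinE', rE', hmodel, hsplit, -, hadm, hall⟩ :=
    FramedRep.IsDeRhamWith.exists_hasQlModel_labelledHodgeTateWeights_eq 𝔅 hB hρ
  haveI := hfinE'
  obtain ⟨τ₀, hτ, hfinτ₀, -, -, hHT⟩ := hall τ
  haveI := hfinτ₀
  -- Wach's filtered comparison for the model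
  have hcomp : ∃ (d : ℕ) (𝒷 : Module.Basis (Fin d) 𝔅.B (𝔅.B ⊗[ℚ_[ℓ]] (Fin n → E')))
      (w : Fin d → ℤ),
      (∀ k, 𝒷 k ∈ 𝔅.D ((FramedRep.toContinuousRep rE').restrictScalars ℚ_[ℓ])) ∧
      (∀ k, 𝒷 k ∈ 𝔅.filTensor (Fin n → E') (w k)) ∧
      ∀ (j : ℤ) (x : 𝔅.B ⊗[ℚ_[ℓ]] (Fin n → E')),
        x ∈ 𝔅.filTensor (Fin n → E') j ↔ ∀ k, 𝒷.repr x k ∈ 𝔅.fil (j - w k) := by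
    subst h𝔅
    exact exists_basis_mem_filTensor_iff_of_isDeRham hK _ hadm
  -- the abstract theorem on the model
  have hdet := PeriodRingData.labelledHodgeTateWeights_scalar_comp_det 𝔅 hB hsplit rE' hadm hcomp τ₀
  -- `D_{τ₀}(det rE')` is finite-dimensional (Fontaine's count)
  haveI : FiniteDimensional E' (𝔅.labelD
      (FramedRep.toContinuousRep ((FramedRep.scalar E' 1).comp (FramedRep.det rE'))) τ₀.toRingHom) := by
    set ρ₁ := FramedRep.toContinuousRep ((FramedRep.scalar E' 1).comp (FramedRep.det rE')) with hρ₁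
    haveI : Module.Finite K (𝔅.D (ρ₁.restrictScalars ℚ_[ℓ])) :=
      Module.rank_lt_aleph0_iff.1 ((𝔅.rank_D_le _).trans_lt Cardinal.natCast_lt_aleph0)
    have hD : Module.finrank K (𝔅.D (ρ₁.restrictScalars ℚ_[ℓ])) ≤
        Module.finrank ℚ_[ℓ] (Fin 1 → E') := 𝔅.finrank_D_le_holds _
    haveI := (𝔅.finite_coeffD_and_finrank_le ρ₁ hD).1
    exact Submodule.finiteDimensional_of_le (𝔅.labelD_le_coeffD ρ₁ _)
  rw [hHT, FramedRep.labelledHodgeTateWeights_eq_of_hasQlModel 𝔅 hmodel.scalar_comp_det hsplit τ τ₀ hτ,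
    hdet]

/-- **`LabelledWeightsDetSchema` holds** (`FontainePstLabelledWeightsDetSchema`): for THE pinned datum
`fontainePst K ℓ hK` (period ring `B_dR(K)`, accepted `fontainePst_𝔅_eq_bdRPeriodRingData`; `K/ℚ_ℓ`
finite, accepted `fontainePst_finiteDimensional`), a de Rham `ρ : Γ_K → GL_n(ℚ̄_ℓ)` and a label
`τ : K → ℚ̄_ℓ`: `HT_τ(det ρ) = {Σ HT_τ(ρ)}`. [cite: FontaineAsterisque223III, Exp. III §1.5, Prop. 1.5.2]
[cite: BrinonConrad2009, §6.3] [cite: Patrikis2019, §2.7.1] -/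
theorem LabelledWeightsDetSchema_holds : LabelledWeightsDetSchema := by
  intro ℓ _ K _ _ _ _ _ hK n ρ hρ
  letI := (fontainePst K ℓ hK).algebra
  intro τ
  haveI : Fact (¬ IsUnit ((ℓ : ℕ) : integerC K)) := ⟨not_isUnit_natCast_integerC hK⟩
  haveI : IsAdicComplete (Ideal.span {((ℓ : ℕ) : integerC K)}) (integerC K) :=
    isAdicComplete_integerC_natCast hK
  haveI : FiniteDimensional ℚ_[ℓ] K := fontainePst_finiteDimensional hK
  exact labelledHodgeTateWeights_scalar_comp_det_of_eq_bdR hK _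
    (fontainePst_𝔅_eq_bdRPeriodRingData hK) hρ τ

end Literature.NumberTheory.PAdicHodge

end
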